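import Summits.Ventures.PercRepro.SevenThreeSmallPlanesFrame

/-!
# PercRepro — the `(7,3)` cell, (R6) part (f2): the one-line planes `ℓ₃ ∪ {a}`, `ℓ₃ ∪ {a, b}` (night-3, gen 4)

For a plane `G` with `g = |G| ∈ {4, 5}` points and exactly one three-point line `ℓ` (the conjuncts of the chain's
`NightThree.OneLine M G ℓ`: `ℓ ⊆ G`, `|ℓ| = 3`, `ρ(ℓ) = 2`, every other triple independent): `R₃(G)` is the set
of subsets with `≥ 3` points other than `ℓ` (`R3_eq_of_oneLine`), `λ(B) = [ℓ ⊆ B]` (`lam3_eq_of_oneLine`), the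
`b`-subsets through `ℓ` number `C(g − 3, b − 3)` (`card_filter_subset_powersetCard`), so the profile is
`(C(g,3) − 1)×(3,0) + (g−3)×(4,1) + (C(g,4) − g + 3)×(4,0) + C(g−3,2)×(5,1)`; the cells `cell_lineA_t*`,
`cell_lineAB_t*` give the per-plane inequality (`perPlane_oneLine`).  Axioms: standard.
-/

namespace PercRepro

namespace SevenThree

open Finset ThmH SixThree PerFlat

variable {α : Type*} [DecidableEq α] {M : Matroid α} [M.Finite]

/-- The only rank-`2` triple of a one-line plane is `ℓ`: `λ(B) = [ℓ ⊆ B]`. -/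
theorem lam3_eq_of_oneLine {G ℓ : Finset α} (hℓ3 : ℓ.card = 3) (hℓr : M.eRk (ℓ : Set α) = 2)
    (hfree : ∀ T ∈ G.powersetCard 3, T ≠ ℓ → M.Indep (T : Set α)) {B : Finset α} (hB : B ⊆ G) :
    lam3 M B = if ℓ ⊆ B then 1 else 0 := by
  unfold lam3
  have hset : (B.powersetCard 3).filter (fun T : Finset α => M.eRk (T : Set α) = 2) =
      if ℓ ⊆ B then {ℓ} else ∅ := by
    ext T
    rw [Finset.mem_filter, Finset.mem_powersetCard]
    constructor
    · rintro ⟨⟨hTB, hT3⟩, hr⟩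
      by_cases hTℓ : T = ℓ
      · subst hTℓ
        rw [if_pos hTB]
        exact Finset.mem_singleton_self T
      · exfalso
        have hind := hfree T (Finset.mem_powersetCard.2 ⟨hTB.trans hB, hT3⟩) hTℓ
        rw [hind.eRk_eq_encard, Set.encard_coe_eq_coe_finsetCard, hT3] at hr
        exact absurd hr (by decide)
    · intro hT
      by_cases hℓB : ℓ ⊆ B
      · rw [if_pos hℓB, Finset.mem_singleton] at hT
        subst hT
        exact ⟨⟨hℓB, hℓ3⟩, hℓr⟩
      · rw [if_neg hℓB] at hT
        exact absurd hT (Finset.notMem_empty T)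
  rw [hset]
  by_cases hℓB : ℓ ⊆ B
  · rw [if_pos hℓB, if_pos hℓB, Finset.card_singleton]
  · rw [if_neg hℓB, if_neg hℓB, Finset.card_empty]

/-- `R₃(G)` of a one-line plane with `≤ 5` points: the subsets with `≥ 3` points other than `ℓ`. -/
theorem R3_eq_of_oneLine {G ℓ : Finset α} (hG : G ∈ planes M) (hℓ3 : ℓ.card = 3) (hℓr : M.eRk (ℓ : Set α) = 2)
    (hfree : ∀ T ∈ G.powersetCard 3, T ≠ ℓ → M.Indep (T : Set α)) (hg : G.card ≤ 5) :
    R3 M G = (G.powersetCard 3).erase ℓ ∪ G.powersetCard 4 ∪ G.powersetCard 5 := by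
  have hG3 := (mem_planes.1 hG).2.2
  ext B
  rw [mem_R3_iff, Finset.mem_union, Finset.mem_union, Finset.mem_erase, Finset.mem_powersetCard,
    Finset.mem_powersetCard, Finset.mem_powersetCard]
  constructor
  · rintro ⟨hBG, hr⟩
    have h3 := three_le_card_of_eRk_eq_three hr
    have h5 : B.card ≤ 5 := (Finset.card_le_card hBG).trans hg
    rcases (show B.card = 3 ∨ B.card = 4 ∨ B.card = 5 by omega) with hc | hc | hc
    · left; left
      refine ⟨fun h => ?_, hBG, hc⟩
      rw [h, hℓr] at hr
      exact absurd hr (by decide)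
    · exact Or.inl (Or.inr ⟨hBG, hc⟩)
    · exact Or.inr ⟨hBG, hc⟩
  · intro hB
    have hBG : B ⊆ G := by rcases hB with (h | h) | h <;> first | exact h.2.1 | exact h.1
    refine ⟨hBG, le_antisymm ?_ ?_⟩
    · rw [← hG3]; exact M.eRk_mono (Finset.coe_subset.2 hBG)
    · -- an independent triple inside `B`
      obtain ⟨T, hTB, hT3, hTℓ⟩ : ∃ T ⊆ B, T.card = 3 ∧ T ≠ ℓ := by
        rcases hB with (h | h) | h
        · exact ⟨B, Finset.Subset.refl B, h.2.2, h.1⟩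
        · -- `B` has `4` points: two distinct triples, at most one is `ℓ`
          obtain ⟨x, hx⟩ : B.Nonempty := Finset.card_pos.1 (by omega)
          by_cases hℓB : ℓ ⊆ B
          · obtain ⟨y, hyB, hyℓ⟩ : ∃ y ∈ B, y ∉ ℓ := by
              by_contra hcon
              push Not at hcon
              have : B ⊆ ℓ := fun y hy => hcon y hy
              have := Finset.card_le_card this
              omega
            obtain ⟨z, hzℓ⟩ : ℓ.Nonempty := Finset.card_pos.1 (by omega)
            refine ⟨insert y (ℓ.erase z), ?_, ?_, ?_⟩
            · exact Finset.insert_subset hyB ((Finset.erase_subset z ℓ).trans hℓB)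
            · rw [Finset.card_insert_of_notMem (fun h => hyℓ (Finset.mem_of_mem_erase h)),
                Finset.card_erase_of_mem hzℓ, hℓ3]
            · intro h
              have : y ∈ ℓ := by rw [← h]; exact Finset.mem_insert_self y _
              exact hyℓ this
          · obtain ⟨T, hTB, hT3⟩ := Finset.exists_subset_card_eq (show 3 ≤ B.card by omega)
            exact ⟨T, hTB, hT3, fun h => hℓB (h ▸ hTB)⟩
        · by_cases hℓB : ℓ ⊆ B
          · obtain ⟨y, hyB, hyℓ⟩ : ∃ y ∈ B, y ∉ ℓ := by
              by_contra hcon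
              push Not at hcon
              have : B ⊆ ℓ := fun y hy => hcon y hy
              have := Finset.card_le_card this
              omega
            obtain ⟨z, hzℓ⟩ : ℓ.Nonempty := Finset.card_pos.1 (by omega)
            refine ⟨insert y (ℓ.erase z), ?_, ?_, ?_⟩
            · exact Finset.insert_subset hyB ((Finset.erase_subset z ℓ).trans hℓB)
            · rw [Finset.card_insert_of_notMem (fun h => hyℓ (Finset.mem_of_mem_erase h)),
                Finset.card_erase_of_mem hzℓ, hℓ3]
            · intro h
              have : y ∈ ℓ := by rw [← h]; exact Finset.mem_insert_self y _
              exact hyℓ this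
          · obtain ⟨T, hTB, hT3⟩ := Finset.exists_subset_card_eq (show 3 ≤ B.card by omega)
            exact ⟨T, hTB, hT3, fun h => hℓB (h ▸ hTB)⟩
      have hind := hfree T (Finset.mem_powersetCard.2 ⟨hTB.trans hBG, hT3⟩) hTℓ
      calc (3 : ℕ∞) = M.eRk (T : Set α) := by
            rw [hind.eRk_eq_encard, Set.encard_coe_eq_coe_finsetCard, hT3]; rfl
        _ ≤ M.eRk (B : Set α) := M.eRk_mono (Finset.coe_subset.2 hTB)

/-- The sum over the `b`-subsets of a one-line plane of a function of `(b, λ)`. -/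
theorem sum_powersetCard_oneLine {G ℓ : Finset α} (hℓG : ℓ ⊆ G) (hℓ3 : ℓ.card = 3) (hℓr : M.eRk (ℓ : Set α) = 2)
    (hfree : ∀ T ∈ G.powersetCard 3, T ≠ ℓ → M.Indep (T : Set α)) (f : ℕ → ℕ → ℚ) {b : ℕ} (hb : 3 ≤ b) :
    ∑ B ∈ G.powersetCard b, f B.card (lam3 M B) =
      ((G \ ℓ).card.choose (b - 3) : ℚ) * f b 1 + ((G.card.choose b : ℚ) - ((G \ ℓ).card.choose (b - 3) : ℚ)) * f b 0 := by
  have h1 : ∀ B ∈ G.powersetCard b, f B.card (lam3 M B) = if ℓ ⊆ B then f b 1 else f b 0 := by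
    intro B hB
    rw [Finset.mem_powersetCard] at hB
    rw [lam3_eq_of_oneLine hℓ3 hℓr hfree hB.1, hB.2]
    by_cases h : ℓ ⊆ B
    · rw [if_pos h, if_pos h]
    · rw [if_neg h, if_neg h]
  rw [Finset.sum_congr rfl h1, Finset.sum_ite, Finset.sum_const, Finset.sum_const, nsmul_eq_mul, nsmul_eq_mul]
  have hc := card_filter_subset_powersetCard hℓG (b := b) (by omega)
  rw [hℓ3] at hc
  have hsplit := Finset.card_filter_add_card_filter_not (s := G.powersetCard b) (p := fun B => ℓ ⊆ B)
  rw [Finset.card_powersetCard] at hsplit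
  have hnot : (((G.powersetCard b).filter (fun B => ¬ ℓ ⊆ B)).card : ℚ) =
      (G.card.choose b : ℚ) - ((G \ ℓ).card.choose (b - 3) : ℚ) := by
    rw [← hc]
    have : ((G.powersetCard b).filter (fun B => ¬ ℓ ⊆ B)).card =
        G.card.choose b - ((G.powersetCard b).filter (fun B => ℓ ⊆ B)).card := by omega
    rw [this, Nat.cast_sub (by omega)]
  rw [hc, hnot]

/-- The demand count of a one-line plane at type `t`. -/
theorem card_filter_R3_oneLine {G ℓ : Finset α} (hG : G ∈ planes M) (hℓG : ℓ ⊆ G) (hℓ3 : ℓ.card = 3)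
    (hℓr : M.eRk (ℓ : Set α) = 2) (hfree : ∀ T ∈ G.powersetCard 3, T ≠ ℓ → M.Indep (T : Set α))
    (hg : G.card ≤ 5) (t : ℕ) :
    ((R3 M G).filter (fun B => B.card + t ≤ G.card)).card =
      (if 3 + t ≤ G.card then G.card.choose 3 - 1 else 0) + (if 4 + t ≤ G.card then G.card.choose 4 else 0) +
        (if 5 + t ≤ G.card then G.card.choose 5 else 0) := by
  have hc : ∀ k : ℕ, ((G.powersetCard k).filter (fun B => B.card + t ≤ G.card)).card =
      if k + t ≤ G.card then G.card.choose k else 0 := by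
    intro k
    by_cases hk : k + t ≤ G.card
    · rw [if_pos hk, ← Finset.card_powersetCard]
      congr 1
      apply Finset.filter_true_of_mem
      intro B hB
      rw [(Finset.mem_powersetCard.1 hB).2]
      exact hk
    · rw [if_neg hk, Finset.card_eq_zero, Finset.filter_eq_empty_iff]
      intro B hB
      rw [(Finset.mem_powersetCard.1 hB).2]
      exact hk
  have hc3 : (((G.powersetCard 3).erase ℓ).filter (fun B => B.card + t ≤ G.card)).card =
      if 3 + t ≤ G.card then G.card.choose 3 - 1 else 0 := by
    have hℓmem : ℓ ∈ G.powersetCard 3 := Finset.mem_powersetCard.2 ⟨hℓG, hℓ3⟩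
    by_cases hk : 3 + t ≤ G.card
    · rw [if_pos hk, ← Finset.card_powersetCard, ← Finset.card_erase_of_mem hℓmem]
      congr 1
      apply Finset.filter_true_of_mem
      intro B hB
      rw [(Finset.mem_powersetCard.1 (Finset.mem_of_mem_erase hB)).2]
      exact hk
    · rw [if_neg hk, Finset.card_eq_zero, Finset.filter_eq_empty_iff]
      intro B hB
      rw [(Finset.mem_powersetCard.1 (Finset.mem_of_mem_erase hB)).2]
      exact hk
  have hd12 : Disjoint (((G.powersetCard 3).erase ℓ).filter (fun B => B.card + t ≤ G.card))
      ((G.powersetCard 4).filter (fun B => B.card + t ≤ G.card)) :=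
    Finset.disjoint_filter_filter (Finset.disjoint_of_subset_left (Finset.erase_subset ℓ _)
      (disjoint_powersetCard_of_ne G (by decide)))
  have hd3 : Disjoint (((G.powersetCard 3).erase ℓ).filter (fun B => B.card + t ≤ G.card) ∪
      (G.powersetCard 4).filter (fun B => B.card + t ≤ G.card))
      ((G.powersetCard 5).filter (fun B => B.card + t ≤ G.card)) := by
    rw [Finset.disjoint_union_left]
    exact ⟨Finset.disjoint_filter_filter (Finset.disjoint_of_subset_left (Finset.erase_subset ℓ _)
      (disjoint_powersetCard_of_ne G (by decide))),
      Finset.disjoint_filter_filter (disjoint_powersetCard_of_ne G (by decide))⟩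
  rw [R3_eq_of_oneLine hG hℓ3 hℓr hfree hg, Finset.filter_union, Finset.filter_union,
    Finset.card_union_of_disjoint hd3, Finset.card_union_of_disjoint hd12, hc3, hc 4, hc 5]

/-- The cell sum of a one-line plane with `≤ 5` points. -/
theorem sum_R3_oneLine {G ℓ : Finset α} (hG : G ∈ planes M) (hℓG : ℓ ⊆ G) (hℓ3 : ℓ.card = 3)
    (hℓr : M.eRk (ℓ : Set α) = 2) (hfree : ∀ T ∈ G.powersetCard 3, T ≠ ℓ → M.Indep (T : Set α))
    (hg : G.card ≤ 5) (f : ℕ → ℕ → ℚ) :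
    ∑ B ∈ R3 M G, f B.card (lam3 M B) =
      ((G.card.choose 3 : ℚ) - 1) * f 3 0 +
      (((G \ ℓ).card.choose 1 : ℚ) * f 4 1 + ((G.card.choose 4 : ℚ) - ((G \ ℓ).card.choose 1 : ℚ)) * f 4 0) +
      (((G \ ℓ).card.choose 2 : ℚ) * f 5 1 + ((G.card.choose 5 : ℚ) - ((G \ ℓ).card.choose 2 : ℚ)) * f 5 0) := by
  have hd12 : Disjoint ((G.powersetCard 3).erase ℓ) (G.powersetCard 4) :=
    Finset.disjoint_of_subset_left (Finset.erase_subset ℓ _) (disjoint_powersetCard_of_ne G (by decide))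
  have hd3 : Disjoint ((G.powersetCard 3).erase ℓ ∪ G.powersetCard 4) (G.powersetCard 5) := by
    rw [Finset.disjoint_union_left]
    exact ⟨Finset.disjoint_of_subset_left (Finset.erase_subset ℓ _) (disjoint_powersetCard_of_ne G (by decide)),
      disjoint_powersetCard_of_ne G (by decide)⟩
  rw [R3_eq_of_oneLine hG hℓ3 hℓr hfree hg, Finset.sum_union hd3, Finset.sum_union hd12]
  -- the triples other than `ℓ`: all `(3, 0)`
  have h3 : ∑ B ∈ (G.powersetCard 3).erase ℓ, f B.card (lam3 M B) = ((G.card.choose 3 : ℚ) - 1) * f 3 0 := by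
    have hℓmem : ℓ ∈ G.powersetCard 3 := Finset.mem_powersetCard.2 ⟨hℓG, hℓ3⟩
    have : ∀ B ∈ (G.powersetCard 3).erase ℓ, f B.card (lam3 M B) = f 3 0 := by
      intro B hB
      have hB' := Finset.mem_powersetCard.1 (Finset.mem_of_mem_erase hB)
      rw [lam3_eq_of_oneLine hℓ3 hℓr hfree hB'.1, hB'.2, if_neg]
      intro hℓB
      exact (Finset.ne_of_mem_erase hB) (Finset.eq_of_subset_of_card_le hℓB (by rw [hB'.2, hℓ3])).symm
    rw [Finset.sum_congr rfl this, Finset.sum_const, Finset.card_erase_of_mem hℓmem, Finset.card_powersetCard,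
      nsmul_eq_mul, Nat.cast_sub (Nat.one_le_iff_ne_zero.2 (Nat.pos_iff_ne_zero.1 (Finset.card_pos.2 ⟨ℓ, hℓmem⟩)
        |> fun h => by rw [Finset.card_powersetCard] at h; exact h)), Nat.cast_one]
  rw [h3, sum_powersetCard_oneLine hℓG hℓ3 hℓr hfree f (b := 4) (by norm_num),
    sum_powersetCard_oneLine hℓG hℓ3 hℓr hfree f (b := 5) (by norm_num)]

/-- **The one-line planes at `t = 1, 2, 3`** (`|G| ∈ {4, 5}`). -/
theorem perPlane_oneLine (hs : Simple M) (hrank : M.eRank = 7) {G ℓ : Finset α} (hG : G ∈ planes M)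
    (hℓG : ℓ ⊆ G) (hℓ3 : ℓ.card = 3) (hℓr : M.eRk (ℓ : Set α) = 2)
    (hfree : ∀ T ∈ G.powersetCard 3, T ≠ ℓ → M.Indep (T : Set α)) (hg4 : 4 ≤ G.card) (hg : G.card ≤ 5)
    {t : ℕ} (ht1 : 1 ≤ t) (ht3 : t ≤ 3)
    (ht : M.eRk ((gr M \ G : Finset α) : Set α) + (t : ℕ∞) = 7)
    (hno4 : ∀ L ∈ lines M, (L ∩ G).card ≤ 3)
    (hdem : (UqG M 7 3 G).card ≤ ((R3 M G).filter (fun B => B.card + t ≤ G.card)).card) :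
    (28 / 5 : ℚ) * ((UqG M 7 3 G).card : ℚ) ≤ ∑ S ∈ Yq M 7 3, fRule M G S / D M S := by
  have hcard := card_filter_R3_oneLine hG hℓG hℓ3 hℓr hfree hg t
  have hGℓ : (G \ ℓ).card = G.card - 3 := by rw [Finset.card_sdiff, Finset.inter_eq_left.2 hℓG, hℓ3]
  rcases (show t = 1 ∨ t = 2 ∨ t = 3 by omega) with rfl | rfl | rfl
  · apply perPlane_t1_of_cell hs hrank hG ht hno4 hdem
    rw [sum_R3_oneLine hG hℓG hℓ3 hℓr hfree hg Cells.vOne, hcard, hGℓ]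
    rcases (show G.card = 4 ∨ G.card = 5 by omega) with hc | hc <;> rw [hc] <;>
      norm_num [Nat.choose] <;> linarith [Cells.cell_lineA_t1, Cells.cell_lineAB_t1]
  · apply perPlane_t2_of_cell hs hrank hG ht hno4 hdem
    rw [sum_R3_oneLine hG hℓG hℓ3 hℓr hfree hg Cells.vTwo, hcard, hGℓ]
    rcases (show G.card = 4 ∨ G.card = 5 by omega) with hc | hc <;> rw [hc] <;>
      norm_num [Nat.choose] <;> linarith [Cells.cell_lineA_t2, Cells.cell_lineAB_t2]
  · apply perPlane_t3_of_cell hs hrank hG ht hno4 hdem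
    rw [sum_R3_oneLine hG hℓG hℓ3 hℓr hfree hg Cells.vThree, hcard, hGℓ]
    rcases (show G.card = 4 ∨ G.card = 5 by omega) with hc | hc <;> rw [hc] <;>
      norm_num [Nat.choose] <;> linarith [Cells.cell_lineA_t3, Cells.cell_lineAB_t3]

end SevenThree

end PercRepro
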